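import Summits.QuantumFields.BalabanUV.T4Continuum.Spine.NE3.FrameNormalisationOneLevel
import Literature.MathematicalPhysics.QuantumFieldTheory.Balaban1983to89.BlockAveragingFederbush
import Literature.Analysis.Complex.RungeUnits
import HarnessLib

/-!
# T⁴ programme, node NE3 — census R50 open half (M1), SECOND BRICK: the SIZE of the covariance defect of the one-step double-bar average — the `δ`-twisted exponent,
# frame and double-bar average are within `O(sup‖δ_v⁻¹ − 1‖)` of the untwisted ones (`FrameNormalisationDefectSize`)

Cell `pub-balaban-gaps` (track G2, seat ne3, generation 11), row NE3; census `HOME/ne/NE3.md` §4 R50, §17 (M1).  `FrameNormalisationDefect.dbavgCov_mgauge_general` represents the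
one-step double-bar average (89) of `V₁^{v}`, for an ARBITRARY gauge `v`, as the corner moving-frame transform of the `δ`-FRAMED double-bar average
`D_δ(c) = w_δ(c₋)⁻¹·Ṽ₁(c)·R̄_{0,c}w_δ(c₊)`, `w_δ(y) = exp F_δ(y)`, `F_δ(y) = Σ_{x∈B(y)} L^{−d} log[(R_{0,y}V₁)(Γ_{y,x})·δ_v(y,Γ_{y,x})⁻¹]`, with the covariant block oscillation
`δ_v(y,Γ_{y,x}) = v(y)⁻¹·R(V₀(Γ_{y,x}))v(x)`; the covariance DEFECT is `D_δ − V̿₁`.  This module BOUNDS it — the linear response that the fixed point of (M1) must invert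
(elementary Banach-algebra estimates; the same expressions written inline, so that this file imports `FrameNormalisationOneLevel` and two Literature modules only):

* §1 `norm_twistedSum_sub_Fcov_le` — if every twisted holonomy of the block is within `t` of `1` and every `δ_v(y,Γ)⁻¹` within `η` of `1`, with `t + (1+t)η ≤ ρ < 1`, then
  **`‖F_δ(y) − F(y)‖ ≤ (1 + ρ∕(1−ρ))·(1+t)·η`** (Lipschitz bound of the series logarithm on the `‖· − 1‖ ≤ ρ` ball, `FederbushMean.norm_mlog_sub_mlog_le`, averaged over the block).
* §2 `norm_exp_sub_exp_le_of_near` ∕ `norm_inv_mul_mul_sub_le` — generic: `‖e^{X} − e^{Y}‖ ≤ Λ·e^{φ+Λ}` for `‖X − Y‖ ≤ Λ`, `‖Y‖ ≤ φ` (`Literature.Analysis.Complex.norm_exp_sub_exp_le`); and the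
  perturbation of a product `a⁻¹·b·c` in its outer factors.
* §3 **`norm_twistedDbavg_sub_dbavgCov_le`** — with `‖F_δ − F‖ ≤ Λ` at both endpoints of `c`, `‖F‖ ≤ φ` there, `‖Ṽ₁(c)‖ ≤ τ`, `‖V̄₀(c)‖, ‖V̄₀(c)⁻¹‖ ≤ β`:
  **`‖D_δ(c) − V̿₁(c)‖ ≤ τ·β²·Λ·(e^{4φ+3Λ} + e^{2φ+Λ})`** — first order in `Λ`, hence in `η = sup‖δ_v⁻¹ − 1‖`.

WHAT THIS IS NOT (honest).  The (M1) fixed point itself (smooth corner interpolation with the frame condition restored, jointly with (1.38)) is NOT done; no k-uniformity is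
claimed for the constants here beyond what the letters say; nothing of Bałaban's is asserted (0 def, 0 sorry).  **NE3 NOT proved**; `PairLandauGaugeB8Avg` and the covariant root
NOT proved; spine PROVED 0∕9; finite T⁴ rung (B)+1 — NOT continuum YM on ℝ⁴, NOT infinite volume, NOT mass gap, NOT `BetaPertH`, NOT Clay.  HONEST DEPENDENCY: continuum YM
on T⁴ ⇐ BetaPertH ∧ nine spine estimates (0/9 proved); BetaPertH ⇐ (D1) ∧ (D4) ∧ CAP+tail; G-an2-4 gates asym, D1 and NE2/3/4.  PLACEMENT:
`Summits/QuantumFields/BalabanUV/T4Continuum/Spine/NE3/`.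

References: [Balaban1985Averaging] T. Bałaban, *Averaging operations for lattice gauge theories*, CMP 98 (1985) 17–51: (21) p. 21, (57)–(59) p. 27, (62) p. 28, (82) p. 30,
(89) p. 31, (93) p. 32.
-/

set_option autoImplicit false

open scoped BigOperators Matrix Matrix.Norms.L2Operator
open NormedSpace

namespace Summit.QuantumFields.BalabanUV.T4Continuum.NE3.FrameNormalisationDefectSize

open Literature.MathematicalPhysics.QuantumFieldTheory.Balaban1983to89
open B7Prop1Explicit B7Prop2Explicit MatrixLog
open B7Eq92Concrete (Rc Rc_apply tHol Fcov wframe tild dbavgCov dbavgCov_apply)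
open FederbushMean (norm_mlog_sub_mlog_le)
open Literature.Analysis.Complex (norm_exp_sub_exp_le norm_exp_le_exp_norm)

noncomputable section

variable {d : ℕ} {n : Type*} [Fintype n] [DecidableEq n]

/-! ## §1 The `δ`-twisted exponent is within `O(η)` of the exponent (62) -/

/-- **`‖F_δ(y) − F(y)‖ ≤ (1 + ρ∕(1−ρ))·(1+t)·η`**: every twisted holonomy `(R_{0,y}V₁)(Γ_{y,x})` within `t` of `1`, every `δ_v(y,Γ_{y,x})⁻¹` within `η` of `1`, `t + (1+t)η ≤ ρ < 1`
(so both arguments of `log` lie in the `‖· − 1‖ ≤ ρ` ball, where `log` is `(1 + ρ∕(1−ρ))`-Lipschitz); the block average of `L^d` such terms with weights `L^{−d}`. [folklore] -/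
theorem norm_twistedSum_sub_Fcov_le [Nonempty n] (L : ℕ) (V₀ V₁ : Site d → Fin d → (Matrix n n ℂ)ˣ) (v : Site d → (Matrix n n ℂ)ˣ) (y : Site d)
    {t η ρ : ℝ} (ht : 0 ≤ t) (hη : 0 ≤ η) (hρ : t + (1 + t) * η ≤ ρ) (hρ1 : ρ < 1)
    (htHol : ∀ r : Fin d → Fin L, ‖((tHol V₀ V₁ y (treeWord (boxVec L r)) : (Matrix n n ℂ)ˣ) : Matrix n n ℂ) - 1‖ ≤ t)
    (hδ : ∀ r : Fin d → Fin L,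
      ‖(((((v y)⁻¹ * Rc (hol V₀ y (treeWord (boxVec L r))) (v (y + boxVec L r)))⁻¹ : (Matrix n n ℂ)ˣ)) : Matrix n n ℂ) - 1‖ ≤ η) :
    ‖(∑ r : Fin d → Fin L, (((L : ℝ) ^ d)⁻¹) •
        mlog ((tHol V₀ V₁ y (treeWord (boxVec L r)) *
          ((v y)⁻¹ * Rc (hol V₀ y (treeWord (boxVec L r))) (v (y + boxVec L r)))⁻¹ : (Matrix n n ℂ)ˣ) : Matrix n n ℂ))
      - Fcov L V₀ V₁ y‖ ≤ (1 + ρ / (1 - ρ)) * ((1 + t) * η) := by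
  set K : ℝ := (1 + ρ / (1 - ρ)) * ((1 + t) * η) with hK
  have hρ0 : 0 ≤ ρ := le_trans (by positivity) hρ
  have hK0 : 0 ≤ K := by
    have : 0 ≤ ρ / (1 - ρ) := div_nonneg hρ0 (by linarith)
    positivity
  have htρ : t ≤ ρ := le_trans (by nlinarith) hρ
  -- each term
  have hterm : ∀ r : Fin d → Fin L,
      ‖mlog ((tHol V₀ V₁ y (treeWord (boxVec L r)) *
          ((v y)⁻¹ * Rc (hol V₀ y (treeWord (boxVec L r))) (v (y + boxVec L r)))⁻¹ : (Matrix n n ℂ)ˣ) : Matrix n n ℂ)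
        - mlog ((tHol V₀ V₁ y (treeWord (boxVec L r)) : (Matrix n n ℂ)ˣ) : Matrix n n ℂ)‖ ≤ K := by
    intro r
    set T : Matrix n n ℂ := ((tHol V₀ V₁ y (treeWord (boxVec L r)) : (Matrix n n ℂ)ˣ) : Matrix n n ℂ) with hT
    set D : Matrix n n ℂ :=
      (((((v y)⁻¹ * Rc (hol V₀ y (treeWord (boxVec L r))) (v (y + boxVec L r)))⁻¹ : (Matrix n n ℂ)ˣ)) : Matrix n n ℂ) with hD
    have hTD : (((tHol V₀ V₁ y (treeWord (boxVec L r)) *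
          ((v y)⁻¹ * Rc (hol V₀ y (treeWord (boxVec L r))) (v (y + boxVec L r)))⁻¹ : (Matrix n n ℂ)ˣ) : Matrix n n ℂ)) = T * D := by
      rw [Units.val_mul]
    rw [hTD]
    have hTn : ‖T‖ ≤ 1 + t := by
      have h := norm_le_norm_add_norm_sub' T 1  -- ‖T‖ ≤ ‖1‖ + ‖T - 1‖
      rw [norm_one] at h
      linarith [htHol r]
    have hdiff : ‖T * D - T‖ ≤ (1 + t) * η := by
      have h1 : T * D - T = T * (D - 1) := by rw [mul_sub, mul_one]
      rw [h1]
      exact (norm_mul_le _ _).trans (mul_le_mul hTn (hδ r) (norm_nonneg _) (by linarith))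
    have hA : ‖T * D - 1‖ ≤ ρ := by
      have h1 : T * D - 1 = (T * D - T) + (T - 1) := by abel
      rw [h1]
      exact (norm_add_le _ _).trans (by linarith [htHol r])
    have hB : ‖T - 1‖ ≤ ρ := (htHol r).trans htρ
    calc ‖mlog (T * D) - mlog T‖ ≤ (1 + ρ / (1 - ρ)) * ‖T * D - T‖ := norm_mlog_sub_mlog_le hρ1 hA hB
      _ ≤ (1 + ρ / (1 - ρ)) * ((1 + t) * η) := by
          have : 0 ≤ 1 + ρ / (1 - ρ) := by
            have : 0 ≤ ρ / (1 - ρ) := div_nonneg hρ0 (by linarith)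
            linarith
          exact mul_le_mul_of_nonneg_left hdiff this
  -- the average
  unfold Fcov
  rw [← Finset.sum_sub_distrib]
  have hc0 : 0 ≤ ((L : ℝ) ^ d)⁻¹ := by positivity
  calc ‖∑ r : Fin d → Fin L, ((((L : ℝ) ^ d)⁻¹) •
          mlog ((tHol V₀ V₁ y (treeWord (boxVec L r)) *
            ((v y)⁻¹ * Rc (hol V₀ y (treeWord (boxVec L r))) (v (y + boxVec L r)))⁻¹ : (Matrix n n ℂ)ˣ) : Matrix n n ℂ)
          - (((L : ℝ) ^ d)⁻¹) • mlog ((tHol V₀ V₁ y (treeWord (boxVec L r)) : (Matrix n n ℂ)ˣ) : Matrix n n ℂ))‖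
      ≤ ∑ r : Fin d → Fin L, ((L : ℝ) ^ d)⁻¹ * K := by
        refine (norm_sum_le _ _).trans (Finset.sum_le_sum fun r _ => ?_)
        rw [← smul_sub, norm_smul, Real.norm_of_nonneg hc0]
        exact mul_le_mul_of_nonneg_left (hterm r) hc0
    _ = ((Fintype.card (Fin d → Fin L) : ℝ) * ((L : ℝ) ^ d)⁻¹) * K := by
        rw [Finset.sum_const, nsmul_eq_mul, Finset.card_univ, mul_assoc]
    _ ≤ 1 * K := by
        refine mul_le_mul_of_nonneg_right ?_ hK0
        rw [Fintype.card_fun, Fintype.card_fin, Fintype.card_fin, Nat.cast_pow]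
        exact mul_inv_le_one
    _ = K := one_mul K

/-! ## §2 Generic Banach-algebra steps: the exponential and the outer factors of `a⁻¹·b·c` -/

/-- `‖e^{X} − e^{Y}‖ ≤ Λ·e^{φ+Λ}` when `‖X − Y‖ ≤ Λ` and `‖Y‖ ≤ φ`. [folklore] -/
theorem norm_exp_sub_exp_le_of_near [Nonempty n] {X Y : Matrix n n ℂ} {Λ φ : ℝ} (hXY : ‖X - Y‖ ≤ Λ) (hY : ‖Y‖ ≤ φ) :
    ‖exp X - exp Y‖ ≤ Λ * Real.exp (φ + Λ) := by
  have hΛ : 0 ≤ Λ := (norm_nonneg _).trans hXY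
  have hX : ‖X‖ ≤ φ + Λ := by
    have h := norm_le_norm_add_norm_sub' X Y
    linarith
  have hmax : max ‖X‖ ‖Y‖ ≤ φ + Λ := max_le hX (by linarith)
  calc ‖exp X - exp Y‖ ≤ ‖X - Y‖ * Real.exp (max ‖X‖ ‖Y‖) := norm_exp_sub_exp_le X Y
    _ ≤ Λ * Real.exp (φ + Λ) := mul_le_mul hXY (Real.exp_le_exp.mpr hmax) (by positivity) hΛ

/-- `‖e^{X}‖ ≤ e^{φ+Λ}` and `‖e^{−X}‖ ≤ e^{φ+Λ}` when `‖X − Y‖ ≤ Λ`, `‖Y‖ ≤ φ`. [folklore] -/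
theorem norm_exp_le_of_near [Nonempty n] {X Y : Matrix n n ℂ} {Λ φ : ℝ} (hXY : ‖X - Y‖ ≤ Λ) (hY : ‖Y‖ ≤ φ) :
    ‖exp X‖ ≤ Real.exp (φ + Λ) ∧ ‖exp (-X)‖ ≤ Real.exp (φ + Λ) := by
  have hX : ‖X‖ ≤ φ + Λ := by
    have h := norm_le_norm_add_norm_sub' X Y
    linarith
  refine ⟨(norm_exp_le_exp_norm X).trans (Real.exp_le_exp.mpr hX), (norm_exp_le_exp_norm (-X)).trans (Real.exp_le_exp.mpr ?_)⟩
  rwa [norm_neg]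

/-- **PERTURBING THE OUTER FACTORS OF `a⁻¹·b·c`**: `a′⁻¹bc′ − a⁻¹bc = a′⁻¹(a − a′)a⁻¹·b·c′ + a⁻¹·b·(c′ − c)`, hence the norm bound. [folklore] -/
theorem norm_inv_mul_mul_sub_le {aI aI' a a' b c c' : Matrix n n ℂ} (ha : aI * a = 1) (ha' : a' * aI' = 1) :
    ‖aI' * b * c' - aI * b * c‖ ≤ ‖aI'‖ * ‖a - a'‖ * ‖aI‖ * ‖b‖ * ‖c'‖ + ‖aI‖ * ‖b‖ * ‖c' - c‖ := by
  have hid : aI' * b * c' - aI * b * c = (aI' * (a - a') * aI) * b * c' + aI * b * (c' - c) := by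
    have h1 : aI' * (a - a') * aI = aI' - aI := by
      rw [mul_sub, sub_mul, mul_assoc aI' a aI]
      -- `aI' * (a * aI)`: need `a * aI = 1`? we only have `aI * a = 1`; use square matrices: left inverse = right inverse
      have haR : a * aI = 1 := mul_eq_one_comm.mp ha
      have haL : aI' * a' = 1 := mul_eq_one_comm.mp ha'
      rw [haR, mul_one, haL, one_mul]
    rw [h1]
    noncomm_ring
  rw [hid]
  refine (norm_add_le _ _).trans (add_le_add ?_ ?_)
  · calc ‖aI' * (a - a') * aI * b * c'‖ ≤ ‖aI' * (a - a') * aI * b‖ * ‖c'‖ := norm_mul_le _ _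
      _ ≤ ‖aI' * (a - a') * aI‖ * ‖b‖ * ‖c'‖ := by gcongr; exact norm_mul_le _ _
      _ ≤ ‖aI' * (a - a')‖ * ‖aI‖ * ‖b‖ * ‖c'‖ := by gcongr; exact norm_mul_le _ _
      _ ≤ ‖aI'‖ * ‖a - a'‖ * ‖aI‖ * ‖b‖ * ‖c'‖ := by gcongr; exact norm_mul_le _ _
  · calc ‖aI * b * (c' - c)‖ ≤ ‖aI * b‖ * ‖c' - c‖ := norm_mul_le _ _
      _ ≤ ‖aI‖ * ‖b‖ * ‖c' - c‖ := by gcongr; exact norm_mul_le _ _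

/-! ## §3 The `δ`-framed double-bar average is within `O(Λ)` of `V̿₁` -/

/-- **GENERIC FORM**: `‖e^{−S₋}·T·(B e^{S₊} B′) − e^{−F₋}·T·(B e^{F₊} B′)‖ ≤ τ·β²·Λ·(e^{4φ+3Λ} + e^{2φ+Λ})` when `‖S_± − F_±‖ ≤ Λ`, `‖F_±‖ ≤ φ`, `‖T‖ ≤ τ`,
`‖B‖, ‖B′‖ ≤ β`. [folklore] -/
theorem norm_framed_sub_framed_le [Nonempty n] {Fm Fp Sm Sp T B BI : Matrix n n ℂ} {Λ φ τ β : ℝ} (hτ : 0 ≤ τ) (hβ : 0 ≤ β)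
    (hSm : ‖Sm - Fm‖ ≤ Λ) (hSp : ‖Sp - Fp‖ ≤ Λ) (hFm : ‖Fm‖ ≤ φ) (hFp : ‖Fp‖ ≤ φ)
    (hT : ‖T‖ ≤ τ) (hB : ‖B‖ ≤ β) (hBI : ‖BI‖ ≤ β) :
    ‖exp (-Sm) * T * (B * exp Sp * BI) - exp (-Fm) * T * (B * exp Fp * BI)‖
      ≤ τ * β ^ 2 * Λ * (Real.exp (4 * φ + 3 * Λ) + Real.exp (2 * φ + Λ)) := by
  letI : NormedAlgebra ℚ (Matrix n n ℂ) := NormedAlgebra.restrictScalars ℚ ℂ (Matrix n n ℂ)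
  have hΛ : 0 ≤ Λ := (norm_nonneg _).trans hSm
  obtain ⟨-, hemI⟩ := norm_exp_le_of_near hSm hFm
  obtain ⟨hep, -⟩ := norm_exp_le_of_near hSp hFp
  have hFmn : ‖-Fm‖ ≤ φ := by rw [norm_neg]; exact hFm
  have heFm : ‖exp (-Fm)‖ ≤ Real.exp φ := (norm_exp_le_exp_norm _).trans (Real.exp_le_exp.mpr hFmn)
  have hdm : ‖exp Fm - exp Sm‖ ≤ Λ * Real.exp (φ + Λ) := by
    rw [norm_sub_rev]; exact norm_exp_sub_exp_le_of_near hSm hFm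
  have hdp : ‖exp Sp - exp Fp‖ ≤ Λ * Real.exp (φ + Λ) := norm_exp_sub_exp_le_of_near hSp hFp
  have hc' : ‖B * exp Sp * BI‖ ≤ β * Real.exp (φ + Λ) * β := by
    calc ‖B * exp Sp * BI‖ ≤ ‖B * exp Sp‖ * ‖BI‖ := norm_mul_le _ _
      _ ≤ ‖B‖ * ‖exp Sp‖ * ‖BI‖ := by gcongr; exact norm_mul_le _ _
      _ ≤ β * Real.exp (φ + Λ) * β := by gcongr
  have hcc : ‖B * exp Sp * BI - B * exp Fp * BI‖ ≤ β * (Λ * Real.exp (φ + Λ)) * β := by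
    have h1 : B * exp Sp * BI - B * exp Fp * BI = B * (exp Sp - exp Fp) * BI := by noncomm_ring
    rw [h1]
    calc ‖B * (exp Sp - exp Fp) * BI‖ ≤ ‖B * (exp Sp - exp Fp)‖ * ‖BI‖ := norm_mul_le _ _
      _ ≤ ‖B‖ * ‖exp Sp - exp Fp‖ * ‖BI‖ := by gcongr; exact norm_mul_le _ _
      _ ≤ β * (Λ * Real.exp (φ + Λ)) * β := by gcongr
  have hinvF : exp (-Fm) * exp Fm = 1 := by
    rw [← exp_add_of_commute (Commute.neg_left (Commute.refl Fm)), neg_add_cancel, exp_zero]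
  have hinvS : exp Sm * exp (-Sm) = 1 := by
    rw [← exp_add_of_commute (Commute.neg_right (Commute.refl Sm)), add_neg_cancel, exp_zero]
  have hmain := norm_inv_mul_mul_sub_le (b := T) (c := B * exp Fp * BI) (c' := B * exp Sp * BI) hinvF hinvS
  refine hmain.trans ?_
  have e1 : ‖exp (-Sm)‖ * ‖exp Fm - exp Sm‖ * ‖exp (-Fm)‖ * ‖T‖ * ‖B * exp Sp * BI‖
      ≤ Real.exp (φ + Λ) * (Λ * Real.exp (φ + Λ)) * Real.exp φ * τ * (β * Real.exp (φ + Λ) * β) := by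
    gcongr
  have e2 : ‖exp (-Fm)‖ * ‖T‖ * ‖B * exp Sp * BI - B * exp Fp * BI‖ ≤ Real.exp φ * τ * (β * (Λ * Real.exp (φ + Λ)) * β) := by
    gcongr
  have hexp1 : Real.exp (φ + Λ) * (Λ * Real.exp (φ + Λ)) * Real.exp φ * τ * (β * Real.exp (φ + Λ) * β)
      = τ * β ^ 2 * Λ * Real.exp (4 * φ + 3 * Λ) := by
    have : Real.exp (4 * φ + 3 * Λ) = Real.exp (φ + Λ) * Real.exp (φ + Λ) * Real.exp φ * Real.exp (φ + Λ) := by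
      rw [← Real.exp_add, ← Real.exp_add, ← Real.exp_add]; ring_nf
    rw [this]; ring
  have hexp2 : Real.exp φ * τ * (β * (Λ * Real.exp (φ + Λ)) * β) = τ * β ^ 2 * Λ * Real.exp (2 * φ + Λ) := by
    have : Real.exp (2 * φ + Λ) = Real.exp φ * Real.exp (φ + Λ) := by
      rw [← Real.exp_add]; ring_nf
    rw [this]; ring
  calc _ ≤ Real.exp (φ + Λ) * (Λ * Real.exp (φ + Λ)) * Real.exp φ * τ * (β * Real.exp (φ + Λ) * β)
          + Real.exp φ * τ * (β * (Λ * Real.exp (φ + Λ)) * β) := add_le_add e1 e2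
    _ = τ * β ^ 2 * Λ * (Real.exp (4 * φ + 3 * Λ) + Real.exp (2 * φ + Λ)) := by rw [hexp1, hexp2]; ring

/-- **`‖D_δ(c) − V̿₁(c)‖ ≤ τ·β²·Λ·(e^{4φ+3Λ} + e^{2φ+Λ})`** for the `δ`-framed double-bar average `D_δ(c) = w_δ(c₋)⁻¹·Ṽ₁(c)·R̄_{0,c}w_δ(c₊)` of
`FrameNormalisationDefect.dbavgCov_mgauge_general` (twisted exponents abstracted as `S₋, S₊`), given at both endpoints of `c = ⟨q, q + Le_κ⟩`: `‖S_± − F(c_±)‖ ≤ Λ` (§1) and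
`‖F(c_±)‖ ≤ φ`, and `‖Ṽ₁(c)‖ ≤ τ`, `‖V̄₀(c)‖ ≤ β`, `‖V̄₀(c)⁻¹‖ ≤ β` (all `≈ 1` in the [B7]-Prop-4 regime). [folklore] -/
theorem norm_twistedDbavg_sub_dbavgCov_le [Nonempty n] (L : ℕ) (V₀ V₁ : Site d → Fin d → (Matrix n n ℂ)ˣ) (q : Site d) (κ : Fin d)
    {Sm Sp : Matrix n n ℂ} {Λ φ τ β : ℝ} (hτ : 0 ≤ τ) (hβ : 0 ≤ β)
    (hSm : ‖Sm - Fcov L V₀ V₁ q‖ ≤ Λ) (hSp : ‖Sp - Fcov L V₀ V₁ (q + (L : ℤ) • e κ)‖ ≤ Λ)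
    (hFm : ‖Fcov L V₀ V₁ q‖ ≤ φ) (hFp : ‖Fcov L V₀ V₁ (q + (L : ℤ) • e κ)‖ ≤ φ)
    (htild : ‖((tild L V₀ V₁ q κ : (Matrix n n ℂ)ˣ) : Matrix n n ℂ)‖ ≤ τ)
    (hbavg : ‖((bavg L V₀ q κ : (Matrix n n ℂ)ˣ) : Matrix n n ℂ)‖ ≤ β) (hbavgI : ‖(((bavg L V₀ q κ)⁻¹ : (Matrix n n ℂ)ˣ) : Matrix n n ℂ)‖ ≤ β) :
    ‖(((expUnit Sm)⁻¹ * tild L V₀ V₁ q κ * Rc (bavg L V₀ q κ) (expUnit Sp) : (Matrix n n ℂ)ˣ) : Matrix n n ℂ)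
        - ((dbavgCov L V₀ V₁ q κ : (Matrix n n ℂ)ˣ) : Matrix n n ℂ)‖
      ≤ τ * β ^ 2 * Λ * (Real.exp (4 * φ + 3 * Λ) + Real.exp (2 * φ + Λ)) := by
  have hL : (((expUnit Sm)⁻¹ * tild L V₀ V₁ q κ * Rc (bavg L V₀ q κ) (expUnit Sp) : (Matrix n n ℂ)ˣ) : Matrix n n ℂ)
      = exp (-Sm) * ((tild L V₀ V₁ q κ : (Matrix n n ℂ)ˣ) : Matrix n n ℂ)
          * (((bavg L V₀ q κ : (Matrix n n ℂ)ˣ) : Matrix n n ℂ) * exp Sp * (((bavg L V₀ q κ)⁻¹ : (Matrix n n ℂ)ˣ) : Matrix n n ℂ)) := by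
    simp only [Units.val_mul, val_inv_expUnit, val_expUnit, Rc_apply]
  have hR : ((dbavgCov L V₀ V₁ q κ : (Matrix n n ℂ)ˣ) : Matrix n n ℂ)
      = exp (-Fcov L V₀ V₁ q) * ((tild L V₀ V₁ q κ : (Matrix n n ℂ)ˣ) : Matrix n n ℂ)
          * (((bavg L V₀ q κ : (Matrix n n ℂ)ˣ) : Matrix n n ℂ) * exp (Fcov L V₀ V₁ (q + (L : ℤ) • e κ))
              * (((bavg L V₀ q κ)⁻¹ : (Matrix n n ℂ)ˣ) : Matrix n n ℂ)) := by
    rw [dbavgCov_apply]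
    simp only [wframe, Units.val_mul, val_inv_expUnit, val_expUnit, Rc_apply]
  rw [hL, hR]
  exact norm_framed_sub_framed_le hτ hβ hSm hSp hFm hFp htild hbavg hbavgI

end

end Summit.QuantumFields.BalabanUV.T4Continuum.NE3.FrameNormalisationDefectSize
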